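import Summits.HodgeConjecture.HodgeConjecture.Theorems.Ring2AbelianAllAndreSpreadLattice
import Summits.HodgeConjecture.HodgeConjecture.Theorems.Ring2AbelianAllAndreNumericalCM
import HarnessLib

/-!
# Ring 2 · sub-cell AbelianAll (ALL ABELIAN VARIETIES), André axis, part XIX-b — Num^CM IS EXACT: granted the
# classical curve-base spreading (part XIX-a's hypothesis shape `SpreadCurve[]`) and Lemme 6.3.1,
# **`HC_AV ⟺ HC_CM ∧ Num^CM`**; under `HC_CM`, **Num^CM ⟺ (4) ⟺ (3) ⟺ (2) ⟺ (L) ⟺ (L∀)**; and GRADED hom ≡ num: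
# **`HCAtDim d ∧ SpreadCurve[] ⟹ (Num_t)(p,q)` at EVERY point of every compact pencil of abelian `d`-folds** — so the
# bidegree `(2,2)` on abelian-fourfold pencils (part XVIII-i's smallest open instance of the lift) holds modulo
# Moonen–Zarhin 1999 + Markman 2025 + spreading

HONEST FRAMING (page 1, verbatim): **research route, not a corollary; conditional on HC_CM plus one named
minimal statement.** Cell line: research route conditional on HC_CM; not a corollary; Q11.4-sentence-2 already
refuted in dim ≥ 3. Nothing in this file proves a case of the Hodge conjecture for an abelian variety. `HC_CM`,
`HC_AV`, `h₂₁` (André's Lemme 6.3.1) and `SpreadCurve[]` are BINDERS wherever they occur; the reduction item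
`CMToAbelian` (stmt-HodgeConjecture-16267) is NOT closed here.

## What this part adds to parts XVIII-c (Num^CM, `HC_CM ⊢ (L) ⟺ Num^CM`), XIX-a (transport = lift mod spreading), XIX-c (lattice)

* §1 **EXACTNESS OF Num^CM.** `HC_AV ⟹ Num^CM` with `HC` for abelian varieties only (part XVIII-c's on-path row
  needed the Hodge conjecture for the total spaces): `HC_AV ⟹ (L)` (part XIX-a, spreading) and `HC_CM ⊢ (L) ⟺ Num^CM`.
  Hence **`HC_AV ⟺ HC_CM ∧ CMPointedPencilNumerical`** and **`CMToAbelian ⟺ (HC_CM → CMPointedPencilNumerical)`**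
  (mod `h₂₁`, `SpreadCurve[]`): conjecture D for the CM-fibre-supported cycles of the total spaces of compact abelian
  pencils is EXACTLY the complement of `HC_CM` in `HC_AV` — necessary and sufficient, not merely sufficient. For the
  census (REFEREE-AB (iii)): Num^CM (N89) is therefore neither stronger nor weaker than the exact transport nodes;
  with the pending edge `A_pen^CM ⟹ Num^CM` (part XVIII-e) the standard-conjecture node A_pen^CM sits ABOVE an exact node.
* §2 Under `HC_CM` alone (no `h₂₁`): **Num^CM ⟺ (4)** (`cmPointedPencilNumerical_iff_cmAnchoredTransport_of_HC_CM`).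
* §3 GRADED HOM ≡ NUM FROM `HC` OF THE FIBRES: at every point `t` of a compact pencil of abelian `d`-folds,
  `HCAtDim d ∧ SpreadCurve[]` give the lift `(j_t^*)⁻¹ N^p(𝒳_t) ≤ N^p(𝒳) ⊔ ker j_t^*` in EVERY codimension
  (part XIX-c, `comap_le_sup_of_hcAtDim`), hence by part XVIII-c's exactness at an HC fibre **(Num_t)(p,q) for all `p + q = d`**
  (`numerical_of_hcAtDim`): an algebraic class `j_{t*} b` supported on a fibre and numerically orthogonal to
  `N^p(𝒳)` is homologically zero. Instances: `d = 4` modulo `MoonenZarhin1999_codimTwoHodgeClasses_abelianFourfold` +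
  `Markman2025_weilClasses_algebraic_abelianFourfold` (`numerical_of_relDim_four`), `d = 5` with
  `MoonenZarhin1999_codimTwoHodgeClasses_abelianFivefold` as well (`numerical_of_relDim_five`). HONEST ACCOUNTING: the
  bidegree `(2,2)` on fivefolds fibred in abelian fourfolds — named in part XVIII-i as the smallest open instance of
  the lift — is thereby settled MODULO two printed results and one arXiv claim; fact-free in the kernel it stays open,
  and in print the first open relative dimension of Num^CM below `HC_CM` is `d = 6` (the W₆ habitat, `(p,q) = (3,3)`,
  RING2-MAP AA2.79), where `HC` of the non-CM Weil-type fibres is the open question itself.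

EDGE LABELS for RING2-MAP: K[SpreadCurve] throughout (plus the named facts listed in each signature of §3).
No `def`, no `sorry`, no new node; axioms standard.

References: Kleiman1968AlgebraicCycles (§3, conjecture D); VoisinHodgeII2003 (§3.3.1, proof of Thm. 10.19);
CharlesSchnell2014Notes (Prop. 11.3.5, Cor. 11.3.6, Prop. 11.3.11); Andre1996Motifs (Lemme 6.3.1 p. 31, §6.3 a) and
Remarque 2 p. 33); Milne2020HodgeClassesAV (Prop. 1 p. 7); MoonenZarhin1999LowDim (Thms. 0.1–0.2);
Markman2025SecantWeil (Cor. 1.6.1).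
-/

noncomputable section

set_option linter.dupNamespace false

namespace Summit.HodgeConjecture.HodgeConjecture.Ring2.AbelianAll

open CategoryTheory AlgebraicGeometry
open Literature.AlgebraicGeometry Literature.AlgebraicGeometry.Motives
open Literature.AlgebraicGeometry.HodgeTheory
open Literature.AlgebraicTopology.SingularHomology (cupProduct)
open Literature.AlgebraicGeometry.Andre1996 (andre1996_cmAnchoredPencil)
open Literature.AlgebraicGeometry.Deligne1982 (cmLocus)
open Summit.HodgeConjecture.HodgeConjecture
open Summit.HodgeConjecture.HodgeConjecture.Theses
open Summit.HodgeConjecture.HodgeConjecture.Ring2.Deform (CompactAbelianPencilVHC HC_CM_of_HC_AV)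
open Summit.HodgeConjecture.HodgeConjecture.Ring2.ClassTargets (HCAtDim hcAtDim_four_of_weilClassesFourfolds
  hcAtDim_five_of_hcAtDim_four)

variable {𝒳 S : SchemeOver ℂ}

/-- `SpreadCurve[]` — part XIX-a's hypothesis shape (VERBATIM the body of the Literature named fact
`HodgeTheory.spread_algebraicClasses_over_smoothCurve`: spreading fibrewise algebraic rational classes over a smooth
curve; Voisin II §3.3.1 and proof of Thm. 10.19, Charles–Schnell proof of Prop. 11.3.11). NOT vendored: no definition
is made here. [cite: VoisinHodgeII2003, §3.3.1 and §10.2.1, proof of Thm. 10.19] [cite: CharlesSchnell2014Notes, Prop. 11.3.11 (proof)] -/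
local notation3 (prettyPrint := false) "SpreadCurve[]" =>
  ∀ ⦃d q : ℕ⦄ ⦃T W : SchemeOver ℂ⦄ (f : W ⟶ T),
    SmoothOfRelativeDimension 1 T.hom → IrreducibleSpace T.left → IsQuasiProjectiveOver W →
    Flat f.left → IsProper f.left → 1 ≤ q → q ≤ d →
    ∀ S : Set T.left, IsClosed S → S ≠ Set.univ →
      (∀ t : ComplexPoints T, t.pt ∉ S → IsSmoothProjective d (fiberOver f t)) →
      ∀ c : complexBetti W (2 * q), IsRationalClass c →
        (∀ t : ComplexPoints T, t.pt ∉ S →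
          complexBetti.map (fiberι f t) (2 * q) c ∈ algebraicClasses (fiberOver f t) q) →
        ∃ a : complexBetti W (2 * q), a ∈ algebraicClasses W q ∧ IsRationalClass a ∧
          ∃ S' : Set T.left, IsClosed S' ∧ S ⊆ S' ∧ S' ≠ Set.univ ∧
            ∀ t : ComplexPoints T, t.pt ∉ S' →
              complexBetti.map (fiberι f t) (2 * q) (c - a) = 0

/-! ## §1 Num^CM is exact -/

/-- **ON-PATH with `HC_AV` only: `HC_AV ⟹ Num^CM`, granted `SpreadCurve[]`** (`HC_AV ⟹ (L)` by part XIX-a; `HC_AV ⟹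
HC_CM`; `HC_CM ⊢ (L) ⟺ Num^CM` by part XVIII-c). [cite: CharlesSchnell2014Notes, Cor. 11.3.6 (p. 494)]
[cite: Kleiman1968AlgebraicCycles, §3 (D(X))] -/
theorem cmPointedPencilNumerical_of_HC_AV (hSp : SpreadCurve[]) (h : PadicSemiregularLift.HodgeAbelianVarieties) :
    CMPointedPencilNumerical :=
  (cmFibreAlgebraicLift_iff_cmPointedPencilNumerical_of_HC_CM (HC_CM_of_HC_AV h)).1
    (cmFibreAlgebraicLift_of_HC_AV hSp h)

/-- **EXACTNESS OF Num^CM: granted Lemme 6.3.1 and `SpreadCurve[]`, `HC_AV ⟺ HC_CM ∧ CMPointedPencilNumerical`** —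
conjecture D ("hom ≡ num") for the cycles of the total spaces of compact abelian pencils supported on a CM fibre is
EXACTLY what `HC_CM` lacks to give `HC_AV`. `HC_CM`, `h₂₁` BINDERS. research route, not a corollary; conditional on
HC_CM plus one named minimal statement. [cite: Andre1996Motifs, Lemme 6.3.1 (p. 31) and Remarque 2 (p. 33)]
[cite: Kleiman1968AlgebraicCycles, §3 (D(X))] [cite: VoisinHodgeII2003, §3.3.1 and proof of Thm. 10.19] -/
theorem HC_AV_iff_HC_CM_and_cmPointedPencilNumerical (h₂₁ : andre1996_cmAnchoredPencil) (hSp : SpreadCurve[]) :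
    PadicSemiregularLift.HodgeAbelianVarieties ↔ (RankFourFaces.CMAbelianHodge ∧ CMPointedPencilNumerical) :=
  ⟨fun h ↦ ⟨HC_CM_of_HC_AV h, cmPointedPencilNumerical_of_HC_AV hSp h⟩,
    fun h ↦ HC_AV_of_HC_CM_of_cmPointedPencilNumerical h₂₁ h.1 h.2⟩

/-- **The reduction item in numerical form**: granted Lemme 6.3.1 and `SpreadCurve[]`,
`CMToAbelian ⟺ (HC_CM → CMPointedPencilNumerical)`. Nothing closes the item.
[cite: Andre1996Motifs, Remarque 2 (p. 33)] [cite: Kleiman1968AlgebraicCycles, §3 (D(X))] -/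
theorem cmToAbelian_iff_HC_CM_imp_cmPointedPencilNumerical (h₂₁ : andre1996_cmAnchoredPencil) (hSp : SpreadCurve[]) :
    RankFourFaces.CMToAbelian ↔ (RankFourFaces.CMAbelianHodge → CMPointedPencilNumerical) := by
  rw [cmToAbelian_iff_HC_CM_imp_cmFibreAlgebraicLift h₂₁ hSp]
  exact ⟨fun h hCM ↦ (cmFibreAlgebraicLift_iff_cmPointedPencilNumerical_of_HC_CM hCM).1 (h hCM),
    fun h hCM ↦ (cmFibreAlgebraicLift_iff_cmPointedPencilNumerical_of_HC_CM hCM).2 (h hCM)⟩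

/-! ## §2 Under `HC_CM`: Num^CM ⟺ transport -/

/-- **`HC_CM ⊢ Num^CM ⟺ (4)`, granted `SpreadCurve[]`** (Num^CM ⟺ (L) by part XVIII-c; (L) ⟺ (4) by part XIX-a). No
`h₂₁`. `HC_CM` a BINDER. [cite: Kleiman1968AlgebraicCycles, §3 (D(X))] [cite: Andre1996Motifs, §6.3 a) (p. 33)] -/
theorem cmPointedPencilNumerical_iff_cmAnchoredTransport_of_HC_CM (hCM : RankFourFaces.CMAbelianHodge)
    (hSp : SpreadCurve[]) : CMPointedPencilNumerical ↔ CMAnchoredTransport := by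
  rw [← cmFibreAlgebraicLift_iff_cmPointedPencilNumerical_of_HC_CM hCM]
  exact cmFibreAlgebraicLift_iff_cmAnchoredTransport hSp

/-- **`HC_CM ⊢ Num^CM ⟺ (3) ⟺ (2) ⟺ (L∀)`, granted Lemme 6.3.1 and `SpreadCurve[]`** (part XIX-a's
`liftCandidates_iff_of_HC_CM` with §2). `HC_CM`, `h₂₁` BINDERS. [cite: Andre1996Motifs, Remarque 2 (p. 33)] -/
theorem cmPointedPencilNumerical_iff_candidates_of_HC_CM (h₂₁ : andre1996_cmAnchoredPencil)
    (hCM : RankFourFaces.CMAbelianHodge) (hSp : SpreadCurve[]) :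
    (CMPointedPencilNumerical ↔ CMPointedPencilVHC) ∧ (CMPointedPencilNumerical ↔ CompactAbelianPencilVHC) ∧
      (CMPointedPencilNumerical ↔ AlgebraicFixedPart) := by
  obtain ⟨hLA, -, h3, h2⟩ := liftCandidates_iff_of_HC_CM h₂₁ hCM hSp
  have hN := cmPointedPencilNumerical_iff_cmAnchoredTransport_of_HC_CM hCM hSp
  exact ⟨hN.trans h3.symm, hN.trans h2.symm, hN.trans hLA.symm⟩

/-! ## §3 Graded hom ≡ num from `HC` of the fibres -/

/-- **GRADED HOM ≡ NUM: `HCAtDim d ∧ SpreadCurve[] ⟹ (Num_t)(p,q)` for all `p + q = d`, at EVERY point `t` of every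
compact pencil of abelian `d`-folds** — an algebraic class `j_{t*} b` (`b ∈ N^q(𝒳_t)`) cup-orthogonal to `N^p(𝒳)` is
zero (part XVIII-c's exactness `(Num_t) ⟺ (L)_t` at a fibre satisfying `HC`, fed with part XIX-c's lift
`comap_le_sup_of_hcAtDim`).
[cite: Kleiman1968AlgebraicCycles, §3 (D(X))] [cite: CharlesSchnell2014Notes, Cor. 11.3.6 (p. 494)] -/
theorem numerical_of_hcAtDim (hSp : SpreadCurve[]) {d : ℕ} (h : HCAtDim d) {f : 𝒳 ⟶ S}
    (hf : IsCompactAbelianPencil f d) (t : ComplexPoints S) {p q : ℕ} (hpq : p + q = d) :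
    ∀ b ∈ algebraicClasses (fiberOver f t) q,
      (∀ a ∈ algebraicClasses 𝒳 p,
        cupProduct (show 2 * p + 2 * (q + 1) = 2 * (d + 1) by omega) a (fiberGysin hf t q b) = 0) →
        fiberGysin hf t q b = 0 := by
  obtain ⟨B, hBdim, ⟨eB⟩⟩ := Andre1996.compactPencil_exists_abelianVariety_fiber_dim hf t
  have hB : IsSmoothProjective B.dim B.X := AbelianVariety.isSmoothProjective_holds
  have hHCB := (hodgeConjectureFor_iff_of_isSmoothProjective nonempty_hodgeModel_holds hB).1 (h B hBdim)
  have hp : ∀ c : complexBetti (fiberOver f t) (2 * p), IsRationalClass c →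
      IsOfHodgeType d (fiberOver f t) (2 * p) p p c → c ∈ algebraicClasses (fiberOver f t) p := by
    have h' := hHCB p
    rw [hBdim] at h'
    exact (forall_hodgeClass_mem_algebraicClasses_iff_of_iso eB p).1 h'
  exact numerical_of_comap_le_sup_of_hodge hf t hpq hp (comap_le_sup_of_hcAtDim hSp h hf p t)

/-- **`d = 4`: (Num_t)(p,q) in EVERY bidegree at EVERY point of every compact pencil of abelian FOURFOLDS**, modulo
`SpreadCurve[]`, Moonen–Zarhin 1999 Thm. 0.1 and Markman 2025 (through `ClassTargets.hcAtDim_four_of_weilClassesFourfolds`).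
In particular the bidegree `(2,2)` named in part XVIII-i as the smallest open instance of the lift — conjecture D in
codimension `3` on the fivefold total space for the classes `j_{t*} N²(𝒳_t)` — holds modulo these inputs.
[cite: MoonenZarhin1999LowDim, Thm. 0.1 with (1.4), (1.9)] [cite: Markman2025SecantWeil, Cor. 1.6.1]
[cite: Kleiman1968AlgebraicCycles, §3 (D(X))] -/
theorem numerical_of_relDim_four (hSp : SpreadCurve[])
    (h01 : MoonenZarhin1999_codimTwoHodgeClasses_abelianFourfold)
    (hM : Markman2025_weilClasses_algebraic_abelianFourfold) {f : 𝒳 ⟶ S} (hf : IsCompactAbelianPencil f 4)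
    (t : ComplexPoints S) {p q : ℕ} (hpq : p + q = 4) :
    ∀ b ∈ algebraicClasses (fiberOver f t) q,
      (∀ a ∈ algebraicClasses 𝒳 p,
        cupProduct (show 2 * p + 2 * (q + 1) = 2 * (4 + 1) by omega) a (fiberGysin hf t q b) = 0) →
        fiberGysin hf t q b = 0 :=
  numerical_of_hcAtDim hSp (hcAtDim_four_of_weilClassesFourfolds h01 hM) hf t hpq

/-- **`d = 5`: (Num_t)(p,q) in every bidegree at every point of every compact pencil of abelian FIVEFOLDS**, modulo
`SpreadCurve[]`, Moonen–Zarhin 1999 Thms. 0.1–0.2 and Markman 2025 (`ClassTargets.hcAtDim_five_of_hcAtDim_four`).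
[cite: MoonenZarhin1999LowDim, Thm. 0.2 with (2.8), §5 (5.11)] [cite: Markman2025SecantWeil, Cor. 1.6.1]
[cite: Kleiman1968AlgebraicCycles, §3 (D(X))] -/
theorem numerical_of_relDim_five (hSp : SpreadCurve[])
    (h01 : MoonenZarhin1999_codimTwoHodgeClasses_abelianFourfold)
    (h02 : MoonenZarhin1999_codimTwoHodgeClasses_abelianFivefold)
    (hM : Markman2025_weilClasses_algebraic_abelianFourfold) {f : 𝒳 ⟶ S} (hf : IsCompactAbelianPencil f 5)
    (t : ComplexPoints S) {p q : ℕ} (hpq : p + q = 5) :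
    ∀ b ∈ algebraicClasses (fiberOver f t) q,
      (∀ a ∈ algebraicClasses 𝒳 p,
        cupProduct (show 2 * p + 2 * (q + 1) = 2 * (5 + 1) by omega) a (fiberGysin hf t q b) = 0) →
        fiberGysin hf t q b = 0 :=
  numerical_of_hcAtDim hSp (hcAtDim_five_of_hcAtDim_four h02 (hcAtDim_four_of_weilClassesFourfolds h01 hM)) hf t hpq

end Summit.HodgeConjecture.HodgeConjecture.Ring2.AbelianAll

end
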